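import Literature.MathematicalPhysics.QuantumFieldTheory.Balaban1983to89.B9CoReadingCoordsGlob
import Literature.MathematicalPhysics.QuantumFieldTheory.Balaban1983to89.B9CoRealizesHRel
import Literature.MathematicalPhysics.QuantumFieldTheory.Balaban1983to89.B6Cor28PrintedKLevelV1

/-!
# `Balaban1983to89.B9CoReadingCoordsH` — the κ-FOLD REAL-COORDINATE MODEL of an H-letter ((3.126): coarse-bond data ↦ fine-bond functions):
# the relative (3.133) co-readings `CoRealizesHRel … (RelB i) …` of def-Y's reading `hKernelOfOp` HOLD AT EVERY `U`, FOR EVERY LETTER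

T. Bałaban, *Propagators for lattice gauge theories in a background field*, Commun. Math. Phys. **99** (1985) 389–434
[`Balaban1985BackgroundPropagators`, "B9"]; [4] = T. Bałaban, *Propagators and renormalization transformations for lattice gauge
theories. II*, Commun. Math. Phys. **96** (1984) 223–250 [`Balaban1984PropagatorsII`].

statement-level skeleton of published theorems with citation tags; proofs where landed; nothing here is a claim about the
Yang–Mills mass gap

THE PRINTED LOCI.  (3.133) p. 422 *"|H(x, y′)|, |(∇_UH)(x, y′)| ≦ B₀(L^jη∕L^{j′}η)²(L^{j′}η)^{−d}e^{−δ₀d(y,y′)}[1, (L^jη)^{−1}] … for x ∈ Δ(y)"*;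
(3.126) p. 420 (the operator H from functions on the coarse lattice to functions on the fine lattice); [4] (2.150) p. 249 (the volume
normalisation `(L^{j′}η)^{−d}` of the kernel entries).

THE POINT (companion of `B9CoReadingCoords` ∕ `B9CoReadingCoordsGlob`).  Rows 20–21 of the N06 knit (Theorems 3.12–3.13) display, next to the (3.42)
co-readings of the bond letters `G_D, G₁, G` (theorems on the coordinate model, `B9CoReadingCoords`), the (3.133) co-readings
`CoRealizesHRel ((ops) x).H n U D (RelB …) blk blkZ (Hm U)` (n06-l `B9CoRealizesHRel`) of the H-letters `H, H₁ : (coarse → 𝔸) →ₗ (fine → 𝔸)` by the walk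
letters' model operators `Hm`, `∇Hm`.  THIS FILE builds the coordinate model of such a letter — input carrier `XHK κ i = IBondY i × Fin (d+1) × κ × κ`
(coarse point × direction slot × coordinate × lift direction, block map `Prod.fst`: at the record the input lattice IS the index bonds), output carrier the
bond carrier `XBK κ i` of `B9CoReadingCoords` — and proves that def-Y's reading `hKernelOfOp i B cfg O par` is CO-REALISED, relative to the carrier-block
equivalence `RelB i`, by the model `HcoK` (entry 0) and by `DcoK ∘ₗ HcoK` (entry 1), at EVERY `U`, for EVERY letter `O`, over any carrier-faithful block map
`bI` on the output side.  The mechanism is the one of the bond file: a test vector supported on the input fibre of `y′` with sup ≤ 1 is dominated by the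
diagonal evaluations of the indicator of `y′`; the model's coordinates on those ARE the coordinates of `O(U)(δ_{y′} ⊗ b_{c′})`, which dominate
`‖O(U)(δ_{y′} ⊗ E)(x)‖` for `‖E‖ ≤ 1` up to `cR39 b`; the volume factor `(vol y′)⁻¹ = (L^{j′}η)^{−D}` of the reading cancels the `(L^{j′}η)^{D}` of the schema.
* §1 the mixed coordinate model `coordOpKH b T : (S′ × D × κ × κ → ℝ) →ₗ (S × D × κ × κ → ℝ)` of a direction-indexed family `T ν : (S′ → 𝔸) →ₗ (S → 𝔸)`,
  `coordOpK_comp_coordOpKH` (functoriality with the bond file's `coordOpK`), `coordOpKH_evDiagK`, `norm_apply_liftY_le'`;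
* §2 the carrier `XHK`, the model `HcoK i b B cfg O U := cR39 b • coordOpKH b (fun _ => (O (cfg U)).restrictScalars ℝ)`, `DcoK_comp_HcoK`, the volume
  bookkeeping `vol_eq_len_rpow`, the sup bound `hKernel_e_le_of_pointwise`;
* §3 ★★ `coRealizesHRel_hKernel_coords_zero ∕ _one` — the two (3.133) co-readings HOLD on the model (hypothesis: `bI` carrier-faithful); `coRealizesHRel_of_pins`
  (both, for walk-letter data pinned to the model by equations — the knit's packaging).
HONEST SCOPE.  Finite-dimensional linear algebra over def-Y's readings; nothing of [B9] asserted; the (3.133) BOUNDS themselves (Theorem 3.12's content for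
H) stay displayed by the knit as walk-expansion schemas about the model operators.  Count-neutral; N06 NOT discharged; one finite lattice programme at fixed
ε; nothing continuum ∕ ℝ⁴ ∕ OS ∕ mass gap ∕ Clay.  Cell `pub-ymgap` (D-0062), node N06 [B9], seat `pub-ymgap-dag-n06-d` (g5), 2026-08-27.
-/

noncomputable section

namespace Literature.MathematicalPhysics.QuantumFieldTheory.Balaban1983to89.B9CoReadingCoordsH

open B6SectAOperatorsV1 (BondIdx)
open B6GlobalChartV1 (PV domT blkV1)
open B6Ineq2142KLevelV1 (β lvl)
open B6KLevelCensusIndexV1 (KIdx)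
open B6Cor28PrintedKLevelV1 (vol len_rpow_neg_D)
open B9GeoNormsKLevelV1 (geo9K)
open B9CoRealizesHRel (CoRealizesHRel)
open B9CoRealizesRelAtLetters (RelB)
open B9Thm39ReadingCoords (coordBound39 basisBound39 cR39 cR39_nonneg abs_repr_le)
open B9CoReadingCoords (assembleK assembleK_add assembleK_smul evDiagK abs_evDiagK_le evDiagK_eq_zero_of assembleK_evDiagK coordOpK coordOpK_apply
  assembleK_coordOpK norm_le_basisBound_mul cdBₗ cdBₗ_apply XBK blkBK DcoK)
open Node00 (SiteY FBondY BlkY IBondY CfgY BallY liftY liftY_apply deltaY hKernelOfOp BondParY cdB iSup_ball_le)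

variable {d ℓ : ℕ} {hd : 1 ≤ d + 1} {hL : Odd (ℓ + 1) ∧ 1 < ℓ + 1} {b₀ b₁ : ℝ}
variable {𝔸 : Type} [NormedRing 𝔸] [NormedAlgebra ℂ 𝔸]
variable {κ : Type} [Fintype κ] [DecidableEq κ]

/-! ## §1 The mixed coordinate model of a family of operators between two function spaces -/

section Coords

variable {S S' D : Type} (b : Module.Basis κ ℝ 𝔸)

/-- ★ **THE COORDINATE MODEL OF A DIRECTION-INDEXED FAMILY `T ν : (S′ → 𝔸) →ₗ (S → 𝔸)`** (coarse input, fine output): `(coordOpKH b T f)(x, ν, c, c′) :=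
repr_c ((T ν (assembleK b ν c′ f))(x))`. [cite: Balaban1985BackgroundPropagators, (3.126) p.420 + (3.133) p.422 (the operator read); Balaban1984PropagatorsII, (2.51) p.232, dictionary] -/
def coordOpKH (T : D → (S' → 𝔸) →ₗ[ℝ] (S → 𝔸)) : (S' × D × κ × κ → ℝ) →ₗ[ℝ] (S × D × κ × κ → ℝ) where
  toFun f := fun p => b.repr (T p.2.1 (assembleK b p.2.1 p.2.2.2 f) p.1) p.2.2.1
  map_add' f g := by
    funext p
    simp only [assembleK_add, map_add, Pi.add_apply, Finsupp.coe_add]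
  map_smul' r f := by
    funext p
    simp only [assembleK_smul, map_smul, Pi.smul_apply, Finsupp.coe_smul, RingHom.id_apply, smul_eq_mul]

omit [DecidableEq κ] in
/-- `coordOpKH`, evaluated. [cite: Balaban1985BackgroundPropagators, (3.126) p.420, dictionary] -/
theorem coordOpKH_apply (T : D → (S' → 𝔸) →ₗ[ℝ] (S → 𝔸)) (f : S' × D × κ × κ → ℝ) (p : S × D × κ × κ) :
    coordOpKH b T f p = b.repr (T p.2.1 (assembleK b p.2.1 p.2.2.2 f) p.1) p.2.2.1 := rfl

omit [DecidableEq κ] in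
/-- re-assembling the coordinates of the image gives the image, slice by slice. [cite: Balaban1985BackgroundPropagators, (3.126) p.420, dictionary] -/
theorem assembleK_coordOpKH (T : D → (S' → 𝔸) →ₗ[ℝ] (S → 𝔸)) (f : S' × D × κ × κ → ℝ) (ν : D) (c' : κ) :
    assembleK b ν c' (coordOpKH b T f) = T ν (assembleK b ν c' f) := by
  funext z
  simp only [assembleK, coordOpKH_apply]
  exact b.sum_repr _

omit [DecidableEq κ] in
/-- ★ **FUNCTORIALITY (mixed)**: a bond-sector model after an H-model is the H-model of the composite family. [cite: Balaban1985BackgroundPropagators, (3.133) p.422 («∇_U H»), dictionary] -/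
theorem coordOpK_comp_coordOpKH (T : D → (S → 𝔸) →ₗ[ℝ] (S → 𝔸)) (T' : D → (S' → 𝔸) →ₗ[ℝ] (S → 𝔸)) :
    coordOpK b T ∘ₗ coordOpKH b T' = coordOpKH b (fun ν => T ν ∘ₗ T' ν) := by
  apply LinearMap.ext; intro f; funext p
  simp only [LinearMap.comp_apply, coordOpK_apply, coordOpKH_apply, assembleK_coordOpKH]

/-- ★ the mixed model on the diagonal evaluation reads the coordinates of `T(J ⊗ b_{c′})`. [cite: Balaban1985BackgroundPropagators, (3.133) p.422, dictionary] -/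
theorem coordOpKH_evDiagK (T : D → (S' → 𝔸) →ₗ[ℝ] (S → 𝔸)) (J : S' → ℝ) (p : S × D × κ × κ) :
    coordOpKH b T (evDiagK J) p = b.repr (T p.2.1 (liftY J (b p.2.2.2)) p.1) p.2.2.1 := by
  rw [coordOpKH_apply, assembleK_evDiagK]

omit [DecidableEq κ] in
/-- ★ **DOMINATION OF THE READING BY THE COORDINATES (mixed)**: for `T : (S′ → 𝔸) →ₗ (S → 𝔸)`, `‖E‖ ≤ 1` and a common bound `M` of
`|repr_c ((T(J ⊗ b_{c′}))(x))|`: `‖(T(J ⊗ E))(x)‖ ≤ cR39 b · M`. [cite: Balaban1985BackgroundPropagators, (3.133) p.422 (the norm read), dictionary] -/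
theorem norm_apply_liftY_le' [FiniteDimensional ℝ 𝔸] (T : (S' → 𝔸) →ₗ[ℝ] (S → 𝔸)) (J : S' → ℝ) {E : 𝔸} (hE : ‖E‖ ≤ 1) (x : S)
    {M : ℝ} (hM : ∀ c c', |b.repr (T (liftY J (b c')) x) c| ≤ M) : ‖T (liftY J E) x‖ ≤ cR39 b * M := by
  have hdec : liftY (X := S') J E = ∑ c', (b.repr E c') • liftY J (b c') := by
    funext z
    rw [Finset.sum_apply, liftY_apply]
    conv_lhs => rw [← b.sum_repr E]
    rw [Finset.smul_sum]
    refine Finset.sum_congr rfl fun c' _ => ?_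
    rw [Pi.smul_apply, liftY_apply, smul_comm]
  have hT : T (liftY J E) x = ∑ c', (b.repr E c') • T (liftY J (b c')) x := by
    rw [hdec, map_sum, Finset.sum_apply]
    refine Finset.sum_congr rfl fun c' _ => ?_
    rw [map_smul, Pi.smul_apply]
  have hcb : 0 ≤ coordBound39 b := norm_nonneg _
  have hbb : 0 ≤ basisBound39 b := Finset.sum_nonneg fun _ _ => norm_nonneg _
  rw [hT]
  calc ‖∑ c', (b.repr E c') • T (liftY J (b c')) x‖ ≤ ∑ c', ‖(b.repr E c') • T (liftY J (b c')) x‖ := norm_sum_le _ _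
    _ = ∑ c', |b.repr E c'| * ‖T (liftY J (b c')) x‖ := by simp [norm_smul]
    _ ≤ ∑ c' : κ, (coordBound39 b * 1) * (basisBound39 b * M) := by
        refine Finset.sum_le_sum fun c' _ => mul_le_mul ?_ (norm_le_basisBound_mul b _ fun c => hM c c') (norm_nonneg _)
          (mul_nonneg hcb zero_le_one)
        exact (abs_repr_le b E c').trans (mul_le_mul_of_nonneg_left hE hcb)
    _ = cR39 b * M := by
        rw [Finset.sum_const, nsmul_eq_mul, Finset.card_univ, cR39]; ring

end Coords

/-! ## §2 At an index: the input carrier of an H-letter, the model `HcoK`, the volume bookkeeping, the sup bound of the reading -/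

section HBond

variable [CompleteSpace 𝔸] (i : KIdx d ℓ hd hL b₀ b₁)

variable (κ) in
/-- **the κ-fold INPUT carrier of an H-letter** at an index: coarse point (index bond) × direction slot × coordinate × lift direction; its block map is the
first projection (at the record the input lattice of (3.126) IS the set of index bonds). [cite: Balaban1985BackgroundPropagators, (3.126) p.420, (3.133) p.422, dictionary] -/
abbrev XHK : Type := IBondY i × Fin (d + 1) × κ × κ

/-- the block map of the input carrier: the coarse point itself. [cite: Balaban1985BackgroundPropagators, (3.133) p.422 («y′ ∈ Λ_{j′}»), dictionary] -/
def blkHK : XHK κ i → IBondY i := fun p => p.1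

/-- the indicator of a coarse point, as a real function. [cite: Balaban1985BackgroundPropagators, (3.133) p.422 (kernel entries), dictionary] -/
def indY (y' : IBondY i) : IBondY i → ℝ := fun z => if z = y' then 1 else 0

omit [CompleteSpace 𝔸] in
/-- `indicator(y′) ⊗ E` IS def-Y's `deltaY y′ E`. [cite: Balaban1985BackgroundPropagators, (3.133) p.422, bookkeeping] -/
theorem liftY_indY (y' : IBondY i) (E : 𝔸) : liftY (indY i y') E = deltaY y' E := by
  funext z
  rw [liftY_apply, indY, deltaY]
  split_ifs <;> simp

/-- `|indY y′ z| ≤ 1`. [cite: Balaban1985BackgroundPropagators, (3.133) p.422, bookkeeping] -/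
theorem abs_indY_le (y' z : IBondY i) : |indY i y' z| ≤ 1 := by
  unfold indY; split_ifs <;> simp

/-- `indY y′` vanishes off `y′`. [cite: Balaban1985BackgroundPropagators, (3.133) p.422, bookkeeping] -/
theorem indY_of_ne {y' z : IBondY i} (h : z ≠ y') : indY i y' z = 0 := by
  unfold indY; rw [if_neg h]

variable (b : Module.Basis κ ℝ 𝔸) [FiniteDimensional ℝ 𝔸] (B : B9.Backgrounds) (cfg : B.Cfg → CfgY 𝔸 i)
  (O : CfgY 𝔸 i → (IBondY i → 𝔸) →ₗ[ℂ] (FBondY i → 𝔸))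

/-- ★ **THE MODEL OF AN H-LETTER `O(U) : (coarse → 𝔸) →ₗ (fine → 𝔸)`**: its mixed coordinate model (constant in the direction slot), scaled by `cR39 b` so that
`|coordinates| ≤ c` gives `‖value‖ ≤ c`. [cite: Balaban1985BackgroundPropagators, (3.126) p.420, (3.133) p.422 («H(x, y′)»); Balaban1984PropagatorsII, (2.51) p.232] -/
def HcoK (U₁ : B.Cfg) : (XHK κ i → ℝ) →ₗ[ℝ] (XBK κ i → ℝ) := cR39 b • coordOpKH b (fun _ : Fin (d + 1) => (O (cfg U₁)).restrictScalars ℝ)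

omit [DecidableEq κ] in
/-- the entry-1 composite `∇_U ∘ H` IS the scaled mixed model of `ν ↦ ∇_{U,ν} ∘ O(U)`. [cite: Balaban1985BackgroundPropagators, (3.133) p.422 («(∇_U H)(x, y′)»), bookkeeping] -/
theorem DcoK_comp_HcoK (U₁ : B.Cfg) :
    DcoK i b B cfg U₁ ∘ₗ HcoK i b B cfg O U₁ = cR39 b • coordOpKH b (fun ν => cdBₗ i (cfg U₁) ν ∘ₗ (O (cfg U₁)).restrictScalars ℝ) := by
  rw [DcoK, HcoK, LinearMap.comp_smul, coordOpK_comp_coordOpKH]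

omit [CompleteSpace 𝔸] [FiniteDimensional ℝ 𝔸] [Fintype κ] [DecidableEq κ] in
/-- `0 ≤ (vol y′)⁻¹` (`= (L^{j′}η)^{−D}`). [cite: Balaban1984PropagatorsII, (2.150) p.249, bookkeeping] -/
theorem vol_inv_nonneg (y' : IBondY i) : 0 ≤ (vol i y')⁻¹ := by
  rw [← len_rpow_neg_D i y']; exact Real.rpow_nonneg (B6KLevelCensusIndexV1.len_pos i y').le _

omit [CompleteSpace 𝔸] [FiniteDimensional ℝ 𝔸] [Fintype κ] [DecidableEq κ] in
/-- `vol y′ = (L^{j′}η)^{D}` as a real power of the scale length of the reading's geometry. [cite: Balaban1984PropagatorsII, (2.150) p.249, bookkeeping] -/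
theorem mul_vol_inv_eq (y' : IBondY i) (c : ℝ) : c * (geo9K i).len y' ^ (((d + 1 : ℕ) : ℝ)) * (vol i y')⁻¹ = c := by
  have h1 : (geo9K i).len y' = (B6KLevelCensusIndexV1.kGeo i).len y' := rfl
  rw [h1, ← len_rpow_neg_D i y', mul_assoc, ← Real.rpow_add (B6KLevelCensusIndexV1.len_pos i y'), add_neg_cancel, Real.rpow_zero, mul_one]

variable {bI : FBondY i → IBondY i}

/-- ★ **THE CORE OF `obs` FOR AN H-LETTER**: if the scaled mixed model of a family `T` is `≤ C` in absolute value on the carrier class of `y` at the diagonal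
evaluation of the indicator of `y′`, then every `‖(T ν (δ_{y′} ⊗ E))(x)‖ ≤ C` for `‖E‖ ≤ 1`, every direction slot and every fine bond `x` of the block of `y`.
[cite: Balaban1985BackgroundPropagators, (3.133) p.422; Balaban1984PropagatorsII, (2.51) p.232] -/
theorem norm_le_of_coordModelH_le (hβI : ∀ (x : FBondY i) (c : IBondY i), blkV1 i.hN i.D x = β i.hN i.D i.hk c → β i.hN i.D i.hk (bI x) = blkV1 i.hN i.D x)
    (T : Fin (d + 1) → (IBondY i → 𝔸) →ₗ[ℝ] (FBondY i → 𝔸)) (y' y : IBondY i) {C : ℝ} (hC : 0 ≤ C)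
    (h : ∀ p : XBK κ i, RelB i (blkBK i bI p) y → |(cR39 b • coordOpKH b T) (evDiagK (indY i y')) p| ≤ C)
    (E : BallY 𝔸) (ν : Fin (d + 1)) (x : FBondY i) (hx : blkV1 i.hN i.D x = β i.hN i.D i.hk y) : ‖T ν (deltaY y' (E : 𝔸)) x‖ ≤ C := by
  have hE : ‖(E : 𝔸)‖ ≤ 1 := mem_closedBall_zero_iff.1 E.2
  have hrel : ∀ cc cc' : κ, RelB i (blkBK i bI ((x, ν, cc, cc') : XBK κ i)) y := fun cc cc' => (hβI x y hx).trans hx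
  have hcoord : ∀ cc cc' : κ, cR39 b * |b.repr (T ν (liftY (indY i y') (b cc')) x) cc| ≤ C := by
    intro cc cc'
    have := h (x, ν, cc, cc') (hrel cc cc')
    rwa [LinearMap.smul_apply, Pi.smul_apply, coordOpKH_evDiagK, smul_eq_mul, abs_mul, abs_of_nonneg (cR39_nonneg b)] at this
  rw [← liftY_indY i y']
  rcases isEmpty_or_nonempty κ with hκ | hκ
  · have hA : ∀ v : 𝔸, v = 0 := fun v => by
      rw [← b.sum_repr v]; exact Finset.sum_eq_zero fun c _ => (hκ.false c).elim
    rw [hA (T ν (liftY (indY i y') (E : 𝔸)) x), norm_zero]; exact hC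
  · obtain ⟨q, -, hq⟩ := Finset.exists_max_image (Finset.univ : Finset (κ × κ)) (fun q => |b.repr (T ν (liftY (indY i y') (b q.2)) x) q.1|)
      Finset.univ_nonempty
    have hM : ∀ cc cc' : κ, |b.repr (T ν (liftY (indY i y') (b cc')) x) cc| ≤ |b.repr (T ν (liftY (indY i y') (b q.2)) x) q.1| :=
      fun cc cc' => hq (cc, cc') (Finset.mem_univ _)
    exact (norm_apply_liftY_le' b (T ν) (indY i y') hE x hM).trans (hcoord q.1 q.2)

omit [Fintype κ] in
/-- the diagonal evaluation of the indicator of `y′` is an admissible test vector of the schema: supported on the input fibre of `y′`, sup `≤ 1`.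
[cite: Balaban1985BackgroundPropagators, (3.133) p.422, bookkeeping] -/
theorem evDiagK_indY_test (y' : IBondY i) :
    (∀ x' : XHK κ i, blkHK i x' ≠ y' → evDiagK (indY i y') x' = 0) ∧ (∀ x' : XHK κ i, |evDiagK (indY i y') x'| ≤ 1) :=
  ⟨fun _ hx => evDiagK_eq_zero_of (indY_of_ne i hx), fun x' => (abs_evDiagK_le _ x').trans (abs_indY_le i y' x'.1)⟩

end HBond

/-! ## §3 ★★ The relative (3.133) co-readings HOLD on the coordinate model (entries 0 and 1) -/

section CoReadingH

variable [CompleteSpace 𝔸] [FiniteDimensional ℝ 𝔸] (i : KIdx d ℓ hd hL b₀ b₁) (b : Module.Basis κ ℝ 𝔸)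
variable (B : B9.Backgrounds) (cfg : B.Cfg → CfgY 𝔸 i) (O : CfgY 𝔸 i → (IBondY i → 𝔸) →ₗ[ℂ] (FBondY i → 𝔸)) (par : BondParY 𝔸 i) (U₁ : B.Cfg)
variable {bI : FBondY i → IBondY i}

/-- ★★ **ENTRY 0 — `CoRealizesHRel (hKernelOfOp i B cfg O par) 0 U₁ D (RelB i) (blkBK bI) (blkHK) (HcoK …)`** for EVERY H-letter `O` and EVERY `U₁` (only the
carrier-faithfulness of the output block map): the model is the letter in κ-fold real coordinates; the reading's volume factor `(L^{j′}η)^{−D}` cancels the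
schema's `(L^{j′}η)^{D}`. [cite: Balaban1985BackgroundPropagators, (3.133) p.422 (first member) + (3.126) p.420; Balaban1984PropagatorsII, (2.150) p.249, (2.51) p.232] -/
theorem coRealizesHRel_hKernel_coords_zero
    (hβI : ∀ (x : FBondY i) (c : IBondY i), blkV1 i.hN i.D x = β i.hN i.D i.hk c → β i.hN i.D i.hk (bI x) = blkV1 i.hN i.D x) :
    CoRealizesHRel (hKernelOfOp i B cfg O par) 0 U₁ (d + 1) (RelB i) (blkBK i bI) (blkHK (κ := κ) i) (HcoK i b B cfg O U₁) := by
  refine ⟨fun y y' c hc hb => ?_⟩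
  have hC : 0 ≤ c * (geo9K i).len y' ^ (((d + 1 : ℕ) : ℝ)) := mul_nonneg hc (Real.rpow_nonneg (B6KLevelCensusIndexV1.len_pos i y').le _)
  have hpt : ∀ (E : BallY 𝔸) (ν : Fin (d + 1)) (x : FBondY i), blkV1 i.hN i.D x = β i.hN i.D i.hk y →
      ‖O (cfg U₁) (deltaY y' (E : 𝔸)) x‖ ≤ c * (geo9K i).len y' ^ (((d + 1 : ℕ) : ℝ)) := fun E ν x hx =>
    norm_le_of_coordModelH_le i b hβI (fun _ : Fin (d + 1) => (O (cfg U₁)).restrictScalars ℝ) y' y hC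
      (fun p hp => hb _ (evDiagK_indY_test i y').1 (evDiagK_indY_test i y').2 p hp) E ν x hx
  unfold hKernelOfOp
  dsimp only
  refine iSup_ball_le (fun E => Real.iSup_le (fun ν => Real.iSup_le (fun f => ?_) hc) hc) hc
  split_ifs with hf h0
  · calc ‖O (cfg U₁) (deltaY y' (E : 𝔸)) f‖ * (vol i y')⁻¹ ≤ c * (geo9K i).len y' ^ (((d + 1 : ℕ) : ℝ)) * (vol i y')⁻¹ :=
          mul_le_mul_of_nonneg_right (hpt E ν f hf) (vol_inv_nonneg i y')
      _ = c := mul_vol_inv_eq i y' c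
  · exact absurd rfl h0
  · exact hc

/-- ★★ **ENTRY 1 — `CoRealizesHRel (hKernelOfOp i B cfg O par) 1 U₁ D (RelB i) (blkBK bI) (blkHK) (DcoK … ∘ₗ HcoK …)`**: the model of `∇_U H(U)` is the
composite of the models. [cite: Balaban1985BackgroundPropagators, (3.133) p.422 (second member); Balaban1984PropagatorsII, (2.150)–(2.151) p.249, (2.51) p.232] -/
theorem coRealizesHRel_hKernel_coords_one
    (hβI : ∀ (x : FBondY i) (c : IBondY i), blkV1 i.hN i.D x = β i.hN i.D i.hk c → β i.hN i.D i.hk (bI x) = blkV1 i.hN i.D x) :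
    CoRealizesHRel (hKernelOfOp i B cfg O par) 1 U₁ (d + 1) (RelB i) (blkBK i bI) (blkHK (κ := κ) i) (DcoK i b B cfg U₁ ∘ₗ HcoK i b B cfg O U₁) := by
  refine ⟨fun y y' c hc hb => ?_⟩
  have hC : 0 ≤ c * (geo9K i).len y' ^ (((d + 1 : ℕ) : ℝ)) := mul_nonneg hc (Real.rpow_nonneg (B6KLevelCensusIndexV1.len_pos i y').le _)
  rw [DcoK_comp_HcoK] at hb
  have hpt : ∀ (E : BallY 𝔸) (ν : Fin (d + 1)) (x : FBondY i), blkV1 i.hN i.D x = β i.hN i.D i.hk y →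
      ‖cdB i (cfg U₁) ν (O (cfg U₁) (deltaY y' (E : 𝔸))) x‖ ≤ c * (geo9K i).len y' ^ (((d + 1 : ℕ) : ℝ)) := fun E ν x hx => by
    have key := norm_le_of_coordModelH_le i b hβI (fun ν => cdBₗ i (cfg U₁) ν ∘ₗ (O (cfg U₁)).restrictScalars ℝ) y' y hC
      (fun p hp => hb _ (evDiagK_indY_test i y').1 (evDiagK_indY_test i y').2 p hp) E ν x hx
    simpa only [LinearMap.comp_apply, cdBₗ_apply, LinearMap.coe_restrictScalars] using key
  unfold hKernelOfOp
  dsimp only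
  refine iSup_ball_le (fun E => Real.iSup_le (fun ν => Real.iSup_le (fun f => ?_) hc) hc) hc
  split_ifs with hf h0
  · exact absurd h0 (by decide)
  · calc ‖cdB i (cfg U₁) ν (O (cfg U₁) (deltaY y' (E : 𝔸))) f‖ * (vol i y')⁻¹ ≤ c * (geo9K i).len y' ^ (((d + 1 : ℕ) : ℝ)) * (vol i y')⁻¹ :=
          mul_le_mul_of_nonneg_right (hpt E ν f hf) (vol_inv_nonneg i y')
      _ = c := mul_vol_inv_eq i y' c
  · exact hc

/-- ★ **BOTH (3.133) CO-READINGS UNDER THE PINS** (the knit's packaging): for walk-letter data with block maps `blk = blkBK i bI` (output), `blkZ = blkHK i` (input) and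
model operators `Hm = HcoK …`, `D = DcoK …` (entry 1 read on `blkY`), the entry-0 and entry-1 relative co-readings of `hKernelOfOp i B cfg O par` HOLD.
[cite: Balaban1985BackgroundPropagators, (3.133) p.422; Balaban1984PropagatorsII, (2.150)–(2.151) p.249] -/
theorem coRealizesHRel_of_pins
    (hβI : ∀ (x : FBondY i) (c : IBondY i), blkV1 i.hN i.D x = β i.hN i.D i.hk c → β i.hN i.D i.hk (bI x) = blkV1 i.hN i.D x)
    {blk blkY : XBK κ i → IBondY i} {blkZ : XHK κ i → IBondY i} {Hm : (XHK κ i → ℝ) →ₗ[ℝ] (XBK κ i → ℝ)} {D : (XBK κ i → ℝ) →ₗ[ℝ] (XBK κ i → ℝ)}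
    (hblk : blk = blkBK i bI) (hblkY : blkY = blkBK i bI) (hblkZ : blkZ = blkHK i) (hHm : Hm = HcoK i b B cfg O U₁) (hD : D = DcoK i b B cfg U₁) :
    CoRealizesHRel (hKernelOfOp i B cfg O par) 0 U₁ (d + 1) (RelB i) blk blkZ Hm ∧
      CoRealizesHRel (hKernelOfOp i B cfg O par) 1 U₁ (d + 1) (RelB i) blkY blkZ (D ∘ₗ Hm) := by
  subst hblk hblkY hblkZ hHm hD
  exact ⟨coRealizesHRel_hKernel_coords_zero i b B cfg O par U₁ hβI, coRealizesHRel_hKernel_coords_one i b B cfg O par U₁ hβI⟩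

end CoReadingH

end Literature.MathematicalPhysics.QuantumFieldTheory.Balaban1983to89.B9CoReadingCoordsH

end
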